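import Literature.Geometry.Riemannian.MetricFlowFDistanceKernelClose
import Literature.Geometry.Riemannian.MetricFlowCorrespondence
import Literature.Geometry.Riemannian.MetricFlowFDistanceComm
import HarnessLib

/-!
# The pushed-forward conjugate heat kernels along an `𝔽`-Cauchy chain form a `W₁`-Cauchy sequence
# (Bamler 2023, §5.4, Lemma 5.20, Claim 5.21 — existence part)

R. Bamler, *Compactness theory of the space of super Ricci flows*, Invent. Math. 233 (2023), §5.4,
proof of Lemma 5.20 (arXiv v1 Lemma 121: a Cauchy sequence of metric flow pairs within a
correspondence `ℭ` with complete comparison spaces `(Z_t, d^Z_t)` has a limit within `ℭ`),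
Claim 5.21 (arXiv v1 Claim 122): *"For every `s, t ∈ I ∖ E^∞`, `s ≤ t` and `x^∞ ∈ X^∞_t` and every
sequence `xⁱ ∈ 𝒳ⁱ_t` with `φⁱ_t(xⁱ) → x^∞` we have `(φⁱ_s)_* νⁱ_{xⁱ;s} → ν^∞_{x^∞;s}` in `W₁`, for
some probability measure `ν^∞_{x^∞;s} ∈ 𝒫(Z_s)` with `supp ν^∞_{x^∞;s} ⊆ X^∞_s`. Moreover, the limit
does not depend on the choice of the sequence `xⁱ`."* Printed proof of the existence part:
*"Consider a sequence `xⁱ ∈ 𝒳ⁱ_t` with `φⁱ_t(xⁱ) → x^∞` and let `r > 0`. Since for large `i`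
`μⁱ_t(B(xⁱ, r)) = ((φⁱ_t)_* μⁱ_t)(B^{Z_t}(φⁱ_t(xⁱ), r)) ≥ ((φⁱ_t)_* μⁱ_t)(B^{Z_t}(x^∞, r/2))`,
we have `liminf_{i → ∞} μⁱ_t(B(xⁱ, r)) > 0`. So the claim … follows from Lemma 5.17"*
(`𝔽`-close flows have `W₁`-close conjugate heat kernels at nearby points carrying mass,
`MetricFlowPair.kernelDistWithin_le_of_fDistWithin_lt`).

This file proves the CORE of the existence part, `MetricFlowPair.cauchySeq_map_condKernel_of_chain`,
in the tree's vocabulary and without reference to the (not yet constructed) limit: given a sequence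
of `H`-concentrated metric flow pairs `P n`, ONE correspondence `ℭ` of the whole family
(`MetricFlow.FamilyCorrespondence`), a stage `i`, a set of times `J ⊆ I''^{,i+k}` (all `k`) over
which the tail `P (i + k)` is `𝔽`-close within `ℭ`,
`d_𝔽^{ℭ.pair (i+k) (i+l), J}(P (i + k), P (i + l)) < d k → 0` (`k ≤ l`), times `s ≤ t` in `J`, and
base points `x k ∈ 𝒳^{i+k}_t` whose images `φ^{i+k}_t(x k)` converge in `Z_t` and whose balls carry
mass uniformly, `liminf_k μ^{i+k}_t(B(x k, r)) > 0` for every `r > 0` (the displayed consequence of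
`φⁱ_t(xⁱ) → x^∞ ∈ supp μ^∞_t`), the push-forwards `(φ^{i+k}_s)_* ν^{i+k}_{x k;s}` form a Cauchy
sequence for `d_{W₁}^{Z_s}`. (With `Z_s` complete this yields the limit `ν^∞_{x^∞;s}`; the support
statement is `support_subset_of_kernel_limit`.)

Proof, as printed: for `ε > 0` pick `r > 0` with `7r < ε`, then `δ > 0` with
`2δ < liminf_k μ^{i+k}_t(B(x k, r))`; for large `k ≤ l`, `μ^{i+k}_t(B̄(x k, r)) ≥ 2δ`,
`d^Z_t(φ^{i+k}_t(x k), φ^{i+l}_t(x l)) ≤ r` and `d_𝔽^{ℭ,J}(P (i+k), P (i+l)) < d k ≤ δ r`, so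
Lemma 5.17 within `ℭ.pair (i + k) (i + l)` gives
`d_{W₁}^{Z_s}((φ^{i+k}_s)_* ν^{i+k}_{x k;s}, (φ^{i+l}_s)_* ν^{i+l}_{x l;s}) ≤ 7r < ε`; the case
`l ≤ k` follows by the symmetry of `d_{W₁}`.

## References

* R. H. Bamler, *Compactness theory of the space of super Ricci flows*, Invent. Math. 233 (2023),
  1121–1277 (arXiv:2008.09298), §5.4, Lemma 5.20 and Claim 5.21 in its proof (arXiv v1
  Lemma 121, Claim 122); §5.3, Lemma 5.17 (arXiv v1 Lemma 117). [Bamler2023]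
-/

noncomputable section

open Set MeasureTheory Filter TopologicalSpace Function
open scoped Topology ENNReal NNReal

namespace Literature.Geometry.Riemannian

universe u

namespace MetricFlowPair

open MetricFlow

/-- **Bamler 2023, Claim 5.21 (arXiv v1 Claim 122), existence part: along an `𝔽`-Cauchy chain
within one correspondence, the pushed-forward conjugate heat kernels based at approximants of a
limit point form a `W₁`-Cauchy sequence.** Let `P n` be `H`-concentrated metric flow pairs, `ℭ` a
correspondence of the family of their flows, `J ⊆ I''^{,i+k}` for all `k`, and suppose
`d_𝔽^{ℭ.pair (i+k) (i+l), J}(P (i + k), P (i + l)) < d k` for `k ≤ l`, with `d k → 0`. Let `s ≤ t`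
lie in `J`, and let `x k ∈ 𝒳^{i+k}_t` satisfy `φ^{i+k}_t(x k) → z` in `Z_t` and
`liminf_k μ^{i+k}_t(B(x k, r)) > 0` for every `r > 0`. Then for every `ε > 0` there is `N` with
`d_{W₁}^{Z_s}((φ^{i+k}_s)_* ν^{i+k}_{x k;s}, (φ^{i+l}_s)_* ν^{i+l}_{x l;s}) < ε` for all `k, l ≥ N`
(by Lemma 5.17, `kernelDistWithin_le_of_fDistWithin_lt`, with `7r < ε` and
`2δ < liminf_k μ^{i+k}_t(B(x k, r))`).
[cite: Bamler2023, §5.4, Lemma 5.20, Claim 5.21 (arXiv v1 Claim 122)] -/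
theorem cauchySeq_map_condKernel_of_chain {I₀ : Set ℝ} {H : ℝ}
    (P : ℕ → MetricFlowPair.{u} I₀) (hP : ∀ n, (P n).flow.IsHConcentrated H)
    (ℭ : FamilyCorrespondence (fun n ↦ (P n).flow) I₀)
    {i : ℕ} {Jgood : Set ℝ} (hdom : ∀ k, Jgood ⊆ ℭ.dom (i + k))
    {d : ℕ → ℝ} (hd : Tendsto d atTop (𝓝 0))
    (hclose : ∀ k l, k ≤ l →
      fDistWithin (P (i + k)) (P (i + l)) (ℭ.pair (i + k) (i + l)) Jgood < ENNReal.ofReal (d k))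
    {s t : ℝ} (hs : s ∈ Jgood) (ht : t ∈ Jgood) (hst : s ≤ t)
    (x : ∀ k, (P (i + k)).flow.Slice ⟨t, (ℭ.dom_subset (i + k) (hdom k ht)).1⟩)
    {z : ℭ.Z ⟨t, (ℭ.dom_subset i (by simpa using hdom 0 ht)).2⟩}
    (hx : Tendsto (fun k ↦ ℭ.φ (i + k) t (hdom k ht) (x k)) atTop (𝓝 z))
    (hmass : ∀ r : ℝ, 0 < r →
      0 < liminf (fun k ↦ (P (i + k)).μ ⟨t, (ℭ.dom_subset (i + k) (hdom k ht)).1⟩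
        (Metric.ball (x k) r)) atTop) :
    ∀ ε : ℝ≥0∞, 0 < ε → ∃ N, ∀ k ≥ N, ∀ l ≥ N,
      wassersteinW1 (X := ℭ.Z ⟨s, (ℭ.dom_subset i (by simpa using hdom 0 hs)).2⟩)
        (((P (i + k)).flow.condKernel (x k) ⟨s, (ℭ.dom_subset (i + k) (hdom k hs)).1⟩).map
          (ℭ.φ (i + k) s (hdom k hs)))
        (((P (i + l)).flow.condKernel (x l) ⟨s, (ℭ.dom_subset (i + l) (hdom l hs)).1⟩).map
          (ℭ.φ (i + l) s (hdom l hs))) < ε := by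
  intro ε hε
  -- `r > 0` with `7r < ε`
  obtain ⟨r, hr, h7r⟩ : ∃ r : ℝ, 0 < r ∧ ENNReal.ofReal (7 * r) < ε := by
    obtain ⟨a, -, h0a, haε⟩ := ENNReal.lt_iff_exists_real_btwn.1 hε
    refine ⟨a / 7, by linarith [ENNReal.ofReal_pos.1 h0a], ?_⟩
    rwa [mul_div_cancel₀ a (by norm_num : (7 : ℝ) ≠ 0)]
  -- `δ > 0` with `2δ < liminf_k μ^{i+k}_t(B(x k, r))`
  obtain ⟨δ, hδ, h2δ⟩ : ∃ δ : ℝ, 0 < δ ∧ ENNReal.ofReal (2 * δ) <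
      liminf (fun k ↦ (P (i + k)).μ ⟨t, (ℭ.dom_subset (i + k) (hdom k ht)).1⟩
        (Metric.ball (x k) r)) atTop := by
    obtain ⟨b, -, h0b, hb⟩ := ENNReal.lt_iff_exists_real_btwn.1 (hmass r hr)
    refine ⟨b / 2, by linarith [ENNReal.ofReal_pos.1 h0b], ?_⟩
    rwa [mul_div_cancel₀ b (by norm_num : (2 : ℝ) ≠ 0)]
  -- eventually: the balls `B(x k, r)` carry mass `> 2δ`, `φ^{i+k}_t(x k)` is `r/2`-close to `z`,
  -- and `d k < δ r`
  have h₁ : ∀ᶠ k in atTop, ENNReal.ofReal (2 * δ) <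
      (P (i + k)).μ ⟨t, (ℭ.dom_subset (i + k) (hdom k ht)).1⟩ (Metric.ball (x k) r) :=
    eventually_lt_of_lt_liminf h2δ
  have h₂ : ∀ᶠ k in atTop, dist (ℭ.φ (i + k) t (hdom k ht) (x k)) z < r / 2 :=
    Metric.tendsto_nhds.1 hx (r / 2) (by positivity)
  have h₃ : ∀ᶠ k in atTop, d k < δ * r := (tendsto_order.1 hd).2 (δ * r) (by positivity)
  obtain ⟨N, hN⟩ := eventually_atTop.1 (h₁.and (h₂.and h₃))
  refine ⟨N, fun k hk l hl ↦ ?_⟩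
  -- Lemma 5.17 within `ℭ.pair (i + k) (i + l)`, for `N ≤ k ≤ l`
  have key : ∀ k l, N ≤ k → N ≤ l → k ≤ l →
      wassersteinW1 (X := ℭ.Z ⟨s, (ℭ.dom_subset i (by simpa using hdom 0 hs)).2⟩)
        (((P (i + k)).flow.condKernel (x k) ⟨s, (ℭ.dom_subset (i + k) (hdom k hs)).1⟩).map
          (ℭ.φ (i + k) s (hdom k hs)))
        (((P (i + l)).flow.condKernel (x l) ⟨s, (ℭ.dom_subset (i + l) (hdom l hs)).1⟩).map
          (ℭ.φ (i + l) s (hdom l hs))) ≤ ENNReal.ofReal (7 * r) := by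
    intro k l hk hl hkl
    obtain ⟨hk₁, hk₂, hk₃⟩ := hN k hk
    obtain ⟨-, hl₂, -⟩ := hN l hl
    have hJ : (ℭ.pair (i + k) (i + l)).FullyDefinedOver Jgood := ⟨hdom k, hdom l⟩
    have hdist : dist (ℭ.φ (i + k) t (hdom k ht) (x k)) (ℭ.φ (i + l) t (hdom l ht) (x l)) ≤ r := by
      have h := dist_triangle_right (ℭ.φ (i + k) t (hdom k ht) (x k))
        (ℭ.φ (i + l) t (hdom l ht) (x l)) z
      linarith
    have hmass' : ENNReal.ofReal (2 * δ) ≤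
        (P (i + k)).μ ⟨t, (ℭ.dom_subset (i + k) (hdom k ht)).1⟩ (Metric.closedBall (x k) r) :=
      hk₁.le.trans (measure_mono Metric.ball_subset_closedBall)
    have hfd : fDistWithin (P (i + k)) (P (i + l)) (ℭ.pair (i + k) (i + l)) Jgood <
        ENNReal.ofReal (δ * r) :=
      (hclose k l hkl).trans_le (ENNReal.ofReal_le_ofReal hk₃.le)
    exact kernelDistWithin_le_of_fDistWithin_lt (hP (i + k)) (hP (i + l))
      (ℭ.pair (i + k) (i + l)) hJ hδ hr hfd hs ht hst (x k) (x l) hdist hmass'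
  rcases le_total k l with hkl | hlk
  · exact (key k l hk hl hkl).trans_lt h7r
  · rw [wassersteinW1_comm]
    exact (key l k hl hk hlk).trans_lt h7r

end MetricFlowPair

end Literature.Geometry.Riemannian

end
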